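import Mathlib
import HarnessLib
import Summits.NavierStokesRegularity.NavierStokesRegularity.Theorems.PoloidalWindowDoorLrcModEntireCurvedTowerElim

/-!
# Route `PoloidalWindowDoor`, item `LrcModEntire` (stmt-NavierStokesRegularity-20428), cell (Q4-curved) of the (TH) column —
# B-ELIM IN HEIGHT CURRENCY: the first integral (‡) of the curvature tower along the parallel web sheet `m = d(z)`, without inverting `d`

Cell ns-regularity-ideate, helper seat ns-k2-port-2 g9 under the LEAD of item 20428 (ns-poloidal-K2-p3 g17).  Companion of `…CurvedTowerElim` (this seat; (s,m)-currency),
for the ASSEMBLY: the bricks B-CRc/B-JETc/B-SPEEDc/B-TSPLITc and K2-p2 g18's B-TWPc all speak the HEIGHT `z` (web point `W(s,z) = Γ(s) + d(z)·JΓ′(s) + z·e₂`, Fermi distance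
`m = d(z)`, `d′ ≠ 0` on the window), so here every `m`-derivative is carried as a `z`-derivative with the weight `d′(z)`: a jet `F₁` is «the `m`-derivative of `F`» iff
`HasDerivAt F (d′(z)·F₁(z)) z`.  `--supports stmt-NavierStokesRegularity-20428 --as helper`.  CLASS-FREE.

* `pi_formula_height`, `tower_identity_abstract_height` — (E1)/(E2) of `…CurvedTowerElim` with `J = 1 − k(s)·d(z)` and weighted jets;
* ★ `tower_first_integral_height` — for `h(s,z) = α(s) + g(z) − c(z)·k(s)/(1 − k(s)d(z))`: the first integral (P) at the height `m = d(z)`,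
  `k″·c₁(z)·J² + k′²·(3d(z)·c₁(z)·J + 4c(z)) − Z(s)·J³ + J³·(e₀ + e₁k + e₂k² + e₃k³)(z) = 0`, `J = 1 − k(s)d(z)`, with `c₁ = c_z/d′`, `c₂ = (c₁)_z/d′`, … the weighted jets and
  `e₀…e₃` the same polynomials in them as in `tower_first_integral` — exactly the input of the LEAD's `…PoleArgumentCurve.pole_argument_along` at the heights `m = d(z)`.

WHAT THIS IS NOT: not a claim about Navier–Stokes regularity and not a stub of the registry; class-free calculus for the residual research cells
`stub_Q4curvedAperiodic` / `stub_Q4sonicLineNegIsolated` of `Cruxes/LrcModEntire/Lines/twist_split.lean` (v14; bears_on LADDER-NS N0 via item 20428; items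
20428 / 19708 / 27893 OPEN).
-/

noncomputable section

set_option linter.dupNamespace false
set_option linter.style.longLine false

namespace Summit.NavierStokesRegularity.NavierStokesRegularity.Theorems.PoloidalWindowDoorLrcModEntireCurvedTowerElimHeight

open Set Function Filter Topology
open Summit.NavierStokesRegularity.NavierStokesRegularity.Theorems.PoloidalWindowDoorLrcModEntireCurvedTowerElim

/-! ### A. Weighted jet-variable elimination -/

section abstractElim

variable {S I : Set ℝ} {k k1 d d1 t t1 t2 : ℝ → ℝ}
  {h hs hss hm hmm hmmm hsm hssm P Ps Pm Psm : ℝ → ℝ → ℝ}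

/-- **(E1) in height currency:** `k′·P = −k′·d(z)·h_s + J·Ξ` at `(s,z)`, `J = 1 − k(s)d(z)`. -/
theorem pi_formula_height (hS : IsOpen S) (hI : IsOpen I)
    (hk : ∀ s ∈ S, HasDerivAt k (k1 s) s)
    (hd : ∀ z ∈ I, HasDerivAt d (d1 z) z) (hd0 : ∀ z ∈ I, d1 z ≠ 0)
    (ht : ∀ z ∈ I, HasDerivAt t (d1 z * t1 z) z)
    (h_ss : ∀ s ∈ S, ∀ z ∈ I, HasDerivAt (fun s' => hs s' z) (hss s z) s)
    (h_m : ∀ s ∈ S, ∀ z ∈ I, HasDerivAt (fun z' => h s z') (d1 z * hm s z) z)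
    (h_mm : ∀ s ∈ S, ∀ z ∈ I, HasDerivAt (fun z' => hm s z') (d1 z * hmm s z) z)
    (P_s : ∀ s ∈ S, ∀ z ∈ I, HasDerivAt (fun s' => P s' z) (Ps s z) s)
    (P_sm : ∀ s ∈ S, ∀ z ∈ I, HasDerivAt (fun z' => Ps s z') (d1 z * Psm s z) z)
    (P_ms : ∀ s ∈ S, ∀ z ∈ I, HasDerivAt (fun s' => Pm s' z) (Psm s z) s)
    (h1 : ∀ s ∈ S, ∀ z ∈ I, hs s z = (1 - k s * d z) * Pm s z - k s * P s z)
    (h2 : ∀ s ∈ S, ∀ z ∈ I, Ps s z = -(1 - k s * d z) * hm s z + k s * h s z + (1 - k s * d z) * t z)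
    {s z : ℝ} (hsS : s ∈ S) (hzI : z ∈ I) :
    k1 s * P s z = -(k1 s * d z * hs s z) + (1 - k s * d z) *
      (3 * (1 - k s * d z) * k s * hm s z - (1 - k s * d z) ^ 2 * hmm s z - 2 * (1 - k s * d z) * k s * t z + (1 - k s * d z) ^ 2 * t1 z
        - k s ^ 2 * h s z - hss s z) := by
  /- (i) `∂_z` of (2′) along the height line, divided by `d′(z) ≠ 0` -/
  have h2ev : (fun z' => -(1 - k s * d z') * hm s z' + k s * h s z' + (1 - k s * d z') * t z') =ᶠ[𝓝 z] fun z' => Ps s z' := by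
    filter_upwards [hI.mem_nhds hzI] with z' hz' using (h2 s hsS z' hz').symm
  have hJz : HasDerivAt (fun z' : ℝ => 1 - k s * d z') (-(k s * d1 z)) z := by
    simpa using ((hd z hzI).const_mul (k s)).const_sub 1
  have hR2 : HasDerivAt (fun z' => -(1 - k s * d z') * hm s z' + k s * h s z' + (1 - k s * d z') * t z')
      (-(-(k s * d1 z) * hm s z + (1 - k s * d z) * (d1 z * hmm s z)) + k s * (d1 z * hm s z)
        + (-(k s * d1 z) * t z + (1 - k s * d z) * (d1 z * t1 z))) z := by
    have key := ((hJz.mul (h_mm s hsS z hzI)).neg.add ((h_m s hsS z hzI).const_mul (k s))).add (hJz.mul (ht z hzI))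
    have hfun : (fun z' => -(1 - k s * d z') * hm s z' + k s * h s z' + (1 - k s * d z') * t z') =
        (fun z' => -((1 - k s * d z') * hm s z') + k s * h s z' + (1 - k s * d z') * t z') := by
      funext z'; ring
    rw [hfun]
    exact key.congr_deriv (by ring)
  have hi' : d1 z * Psm s z = -(-(k s * d1 z) * hm s z + (1 - k s * d z) * (d1 z * hmm s z)) + k s * (d1 z * hm s z)
      + (-(k s * d1 z) * t z + (1 - k s * d z) * (d1 z * t1 z)) :=
    (P_sm s hsS z hzI).unique (hR2.congr_of_eventuallyEq h2ev.symm)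
  have hi : Psm s z = -(-(k s) * hm s z + (1 - k s * d z) * hmm s z) + k s * hm s z + (-(k s) * t z + (1 - k s * d z) * t1 z) := by
    have hne := hd0 z hzI
    have : d1 z * (Psm s z - (-(-(k s) * hm s z + (1 - k s * d z) * hmm s z) + k s * hm s z + (-(k s) * t z + (1 - k s * d z) * t1 z))) = 0 := by
      linear_combination hi'
    rcases mul_eq_zero.1 this with h0 | h0
    · exact absurd h0 hne
    · linarith
  /- (ii) `∂_s` of (1′) along the `s`-line -/
  have h1ev : (fun s' => (1 - k s' * d z) * Pm s' z - k s' * P s' z) =ᶠ[𝓝 s] fun s' => hs s' z := by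
    filter_upwards [hS.mem_nhds hsS] with s' hs' using (h1 s' hs' z hzI).symm
  have hJs : HasDerivAt (fun s' : ℝ => 1 - k s' * d z) (-(k1 s * d z)) s := by
    simpa using ((hk s hsS).mul_const (d z)).const_sub 1
  have hR1 : HasDerivAt (fun s' => (1 - k s' * d z) * Pm s' z - k s' * P s' z)
      ((-(k1 s * d z) * Pm s z + (1 - k s * d z) * Psm s z) - (k1 s * P s z + k s * Ps s z)) s :=
    (hJs.mul (P_ms s hsS z hzI)).sub ((hk s hsS).mul (P_s s hsS z hzI))
  have hii : hss s z = (-(k1 s * d z) * Pm s z + (1 - k s * d z) * Psm s z) - (k1 s * P s z + k s * Ps s z) :=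
    (h_ss s hsS z hzI).unique (hR1.congr_of_eventuallyEq h1ev.symm)
  /- (iii) algebra with (1′), (2′) at the point -/
  have e1 := h1 s hsS z hzI
  have e2 := h2 s hsS z hzI
  linear_combination k1 s * d z * e1 + (1 - k s * d z) * hii + (1 - k s * d z) ^ 2 * hi - (1 - k s * d z) * k s * e2

/-- **(E2) in height currency:** the abstract third-order identity at `(s,z)`, `J = 1 − k(s)d(z)`. -/
theorem tower_identity_abstract_height (hS : IsOpen S) (hI : IsOpen I)
    (hk : ∀ s ∈ S, HasDerivAt k (k1 s) s)
    (hd : ∀ z ∈ I, HasDerivAt d (d1 z) z) (hd0 : ∀ z ∈ I, d1 z ≠ 0)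
    (ht : ∀ z ∈ I, HasDerivAt t (d1 z * t1 z) z) (ht2 : ∀ z ∈ I, HasDerivAt t1 (d1 z * t2 z) z)
    (h_ss : ∀ s ∈ S, ∀ z ∈ I, HasDerivAt (fun s' => hs s' z) (hss s z) s)
    (h_m : ∀ s ∈ S, ∀ z ∈ I, HasDerivAt (fun z' => h s z') (d1 z * hm s z) z)
    (h_mm : ∀ s ∈ S, ∀ z ∈ I, HasDerivAt (fun z' => hm s z') (d1 z * hmm s z) z)
    (h_mmm : ∀ s ∈ S, ∀ z ∈ I, HasDerivAt (fun z' => hmm s z') (d1 z * hmmm s z) z)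
    (h_sm : ∀ s ∈ S, ∀ z ∈ I, HasDerivAt (fun z' => hs s z') (d1 z * hsm s z) z)
    (h_ssm : ∀ s ∈ S, ∀ z ∈ I, HasDerivAt (fun z' => hss s z') (d1 z * hssm s z) z)
    (P_s : ∀ s ∈ S, ∀ z ∈ I, HasDerivAt (fun s' => P s' z) (Ps s z) s)
    (P_m : ∀ s ∈ S, ∀ z ∈ I, HasDerivAt (fun z' => P s z') (d1 z * Pm s z) z)
    (P_sm : ∀ s ∈ S, ∀ z ∈ I, HasDerivAt (fun z' => Ps s z') (d1 z * Psm s z) z)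
    (P_ms : ∀ s ∈ S, ∀ z ∈ I, HasDerivAt (fun s' => Pm s' z) (Psm s z) s)
    (h1 : ∀ s ∈ S, ∀ z ∈ I, hs s z = (1 - k s * d z) * Pm s z - k s * P s z)
    (h2 : ∀ s ∈ S, ∀ z ∈ I, Ps s z = -(1 - k s * d z) * hm s z + k s * h s z + (1 - k s * d z) * t z)
    {s z : ℝ} (hsS : s ∈ S) (hzI : z ∈ I) :
    0 = -((1 - k s * d z) * k1 s * hs s z) - (1 - k s * d z) * k1 s * d z * hsm s z
        - 2 * (1 - k s * d z) * k s *
            (3 * (1 - k s * d z) * k s * hm s z - (1 - k s * d z) ^ 2 * hmm s z - 2 * (1 - k s * d z) * k s * t z + (1 - k s * d z) ^ 2 * t1 z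
              - k s ^ 2 * h s z - hss s z)
        + (1 - k s * d z) ^ 2 *
            (-(4 * k s ^ 2 * hm s z) + 5 * (1 - k s * d z) * k s * hmm s z - (1 - k s * d z) ^ 2 * hmmm s z + 2 * k s ^ 2 * t z
              - 4 * (1 - k s * d z) * k s * t1 z + (1 - k s * d z) ^ 2 * t2 z - hssm s z)
        + k s * k1 s * d z * hs s z - k1 s * hs s z := by
  -- `Ξ` as a function of the height, and its weighted derivative
  set Ξ : ℝ → ℝ := fun z' => 3 * (1 - k s * d z') * k s * hm s z' - (1 - k s * d z') ^ 2 * hmm s z' - 2 * (1 - k s * d z') * k s * t z'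
    + (1 - k s * d z') ^ 2 * t1 z' - k s ^ 2 * h s z' - hss s z' with hΞdef
  set Ξ' : ℝ := -(4 * k s ^ 2 * hm s z) + 5 * (1 - k s * d z) * k s * hmm s z - (1 - k s * d z) ^ 2 * hmmm s z + 2 * k s ^ 2 * t z
    - 4 * (1 - k s * d z) * k s * t1 z + (1 - k s * d z) ^ 2 * t2 z - hssm s z with hΞ'def
  -- (E1) along the height line through `s`
  have hE1 : ∀ z' ∈ I, k1 s * P s z' = -(k1 s * d z' * hs s z') + (1 - k s * d z') * Ξ z' := fun z' hz' => by
    rw [hΞdef]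
    exact pi_formula_height hS hI hk hd hd0 ht h_ss h_m h_mm P_s P_sm P_ms h1 h2 hsS hz'
  have hev : (fun z' => -(k1 s * d z' * hs s z') + (1 - k s * d z') * Ξ z') =ᶠ[𝓝 z] fun z' => k1 s * P s z' := by
    filter_upwards [hI.mem_nhds hzI] with z' hz' using (hE1 z' hz').symm
  have hL : HasDerivAt (fun z' => k1 s * P s z') (k1 s * (d1 z * Pm s z)) z := (P_m s hsS z hzI).const_mul (k1 s)
  have hJz : HasDerivAt (fun z' : ℝ => 1 - k s * d z') (-(k s * d1 z)) z := by
    simpa using ((hd z hzI).const_mul (k s)).const_sub 1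
  have hΞ : HasDerivAt Ξ (d1 z * Ξ') z := by
    have hA : HasDerivAt (fun z' => (1 - k s * d z') * k s * hm s z') (-(k s * d1 z) * k s * hm s z + (1 - k s * d z) * k s * (d1 z * hmm s z)) z :=
      (hJz.mul_const (k s)).mul (h_mm s hsS z hzI)
    have hB : HasDerivAt (fun z' => (1 - k s * d z') ^ 2 * hmm s z')
        (((2 : ℕ) : ℝ) * (1 - k s * d z) ^ (2 - 1) * (-(k s * d1 z)) * hmm s z + (1 - k s * d z) ^ 2 * (d1 z * hmmm s z)) z :=
      (hJz.pow 2).mul (h_mmm s hsS z hzI)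
    have hC : HasDerivAt (fun z' => (1 - k s * d z') * k s * t z') (-(k s * d1 z) * k s * t z + (1 - k s * d z) * k s * (d1 z * t1 z)) z :=
      (hJz.mul_const (k s)).mul (ht z hzI)
    have hD : HasDerivAt (fun z' => (1 - k s * d z') ^ 2 * t1 z')
        (((2 : ℕ) : ℝ) * (1 - k s * d z) ^ (2 - 1) * (-(k s * d1 z)) * t1 z + (1 - k s * d z) ^ 2 * (d1 z * t2 z)) z :=
      (hJz.pow 2).mul (ht2 z hzI)
    have hE : HasDerivAt (fun z' => k s ^ 2 * h s z') (k s ^ 2 * (d1 z * hm s z)) z := (h_m s hsS z hzI).const_mul _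
    have hF := h_ssm s hsS z hzI
    have key := (((((hA.const_mul 3).sub hB).sub (hC.const_mul 2)).add hD).sub hE).sub hF
    have hfun : Ξ = fun z' => 3 * ((1 - k s * d z') * k s * hm s z') - (1 - k s * d z') ^ 2 * hmm s z' - 2 * ((1 - k s * d z') * k s * t z')
        + (1 - k s * d z') ^ 2 * t1 z' - k s ^ 2 * h s z' - hss s z' := by
      funext z'; simp only [hΞdef]; ring
    rw [hfun]
    refine key.congr_deriv ?_
    simp only [hΞ'def]
    push_cast
    ring
  have hR : HasDerivAt (fun z' => -(k1 s * d z' * hs s z') + (1 - k s * d z') * Ξ z')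
      (-(k1 s * d1 z * hs s z + k1 s * d z * (d1 z * hsm s z)) + (-(k s * d1 z) * Ξ z + (1 - k s * d z) * (d1 z * Ξ'))) z :=
    ((((hd z hzI).const_mul (k1 s)).mul (h_sm s hsS z hzI)).neg.add (hJz.mul hΞ))
  have hiv' : k1 s * (d1 z * Pm s z) = -(k1 s * d1 z * hs s z + k1 s * d z * (d1 z * hsm s z)) + (-(k s * d1 z) * Ξ z + (1 - k s * d z) * (d1 z * Ξ')) :=
    hL.unique (hR.congr_of_eventuallyEq hev.symm)
  -- cancel the weight `d′(z) ≠ 0`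
  have hiv : k1 s * Pm s z = -(k1 s * hs s z + k1 s * d z * hsm s z) + (-(k s) * Ξ z + (1 - k s * d z) * Ξ') := by
    have hne := hd0 z hzI
    have : d1 z * (k1 s * Pm s z - (-(k1 s * hs s z + k1 s * d z * hsm s z) + (-(k s) * Ξ z + (1 - k s * d z) * Ξ'))) = 0 := by
      linear_combination hiv'
    rcases mul_eq_zero.1 this with h0 | h0
    · exact absurd h0 hne
    · linarith
  have e1 := h1 s hsS z hzI
  have hE1p := hE1 z hzI
  have hΞz : Ξ z = 3 * (1 - k s * d z) * k s * hm s z - (1 - k s * d z) ^ 2 * hmm s z - 2 * (1 - k s * d z) * k s * t z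
      + (1 - k s * d z) ^ 2 * t1 z - k s ^ 2 * h s z - hss s z := by simp only [hΞdef]
  rw [hΞz] at hiv hE1p
  rw [hΞ'def] at hiv
  linear_combination k1 s * e1 + (1 - k s * d z) * hiv - k s * hE1p

end abstractElim

/-! ### B. The first integral at the height `m = d(z)` -/

section explicitElim

variable {S I : Set ℝ} {k k1 k2 α α1 α2 d d1 c c1 c2 c3 g g1 g2 g3 t t1 t2 : ℝ → ℝ} {P Ps Pm Psm : ℝ → ℝ → ℝ}

/-- ★ **THE FIRST INTEGRAL (P) AT THE HEIGHT `m = d(z)`** — `tower_first_integral` in height currency: weighted jets `c₁, c₂, c₃` of `c`, `g₁, g₂, g₃` of `g`,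
`t₁, t₂` of `t` (`HasDerivAt F (d′·F₁) z`), `d′ ≠ 0` and `1 − k d ≠ 0` on `S × I`, the curved Cauchy–Riemann pair for `h = α + g − c k/(1 − k d)`; conclusion = (P) of
T2B-g17 §14 with `m := d(z)`. -/
theorem tower_first_integral_height (hS : IsOpen S) (hI : IsOpen I)
    (hk : ∀ s ∈ S, HasDerivAt k (k1 s) s) (hk2 : ∀ s ∈ S, HasDerivAt k1 (k2 s) s)
    (hα2 : ∀ s ∈ S, HasDerivAt α1 (α2 s) s)
    (hd : ∀ z ∈ I, HasDerivAt d (d1 z) z) (hd0 : ∀ z ∈ I, d1 z ≠ 0)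
    (hc : ∀ z ∈ I, HasDerivAt c (d1 z * c1 z) z) (hc2 : ∀ z ∈ I, HasDerivAt c1 (d1 z * c2 z) z) (hc3 : ∀ z ∈ I, HasDerivAt c2 (d1 z * c3 z) z)
    (hg : ∀ z ∈ I, HasDerivAt g (d1 z * g1 z) z) (hg2 : ∀ z ∈ I, HasDerivAt g1 (d1 z * g2 z) z) (hg3 : ∀ z ∈ I, HasDerivAt g2 (d1 z * g3 z) z)
    (ht : ∀ z ∈ I, HasDerivAt t (d1 z * t1 z) z) (ht2 : ∀ z ∈ I, HasDerivAt t1 (d1 z * t2 z) z)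
    (hJ : ∀ s ∈ S, ∀ z ∈ I, 1 - k s * d z ≠ 0)
    (P_s : ∀ s ∈ S, ∀ z ∈ I, HasDerivAt (fun s' => P s' z) (Ps s z) s)
    (P_m : ∀ s ∈ S, ∀ z ∈ I, HasDerivAt (fun z' => P s z') (d1 z * Pm s z) z)
    (P_sm : ∀ s ∈ S, ∀ z ∈ I, HasDerivAt (fun z' => Ps s z') (d1 z * Psm s z) z)
    (P_ms : ∀ s ∈ S, ∀ z ∈ I, HasDerivAt (fun s' => Pm s' z) (Psm s z) s)
    (h1 : ∀ s ∈ S, ∀ z ∈ I, α1 s - c z * k1 s / (1 - k s * d z) ^ 2 = (1 - k s * d z) * Pm s z - k s * P s z)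
    (h2 : ∀ s ∈ S, ∀ z ∈ I, Ps s z = -(1 - k s * d z) * (g1 z - k s * c1 z / (1 - k s * d z) - k s ^ 2 * c z / (1 - k s * d z) ^ 2)
      + k s * (α s + g z - c z * k s / (1 - k s * d z)) + (1 - k s * d z) * t z)
    {s z : ℝ} (hsS : s ∈ S) (hzI : z ∈ I) :
    k2 s * c1 z * (1 - k s * d z) ^ 2 + k1 s ^ 2 * (3 * d z * c1 z * (1 - k s * d z) + 4 * c z)
        - (-2 * (k s * α2 s - k1 s * α1 s + k s ^ 3 * α s)) * (1 - k s * d z) ^ 3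
        + (1 - k s * d z) ^ 3 *
          (-(g3 z - t2 z)
            + ((7 * g2 z + c3 z - 6 * t1 z) + 3 * d z * (g3 z - t2 z)) * k s
            + (-2 * (5 * g1 z + 2 * c2 z - 3 * t z) - 2 * d z * (7 * g2 z + c3 z - 6 * t1 z) - 3 * d z ^ 2 * (g3 z - t2 z)) * k s ^ 2
            + (2 * (g z + c1 z) + 2 * d z * (5 * g1 z + 2 * c2 z - 3 * t z) + d z ^ 2 * (7 * g2 z + c3 z - 6 * t1 z) + d z ^ 3 * (g3 z - t2 z)) * k s ^ 3) = 0 := by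
  /- the weighted jets of `h` as explicit functions of `(s,z)` -/
  set h : ℝ → ℝ → ℝ := fun s z => α s + g z - c z * k s / (1 - k s * d z) with hh
  set hs : ℝ → ℝ → ℝ := fun s z => α1 s - c z * k1 s / (1 - k s * d z) ^ 2 with hhs
  set hss : ℝ → ℝ → ℝ := fun s z => α2 s - c z * k2 s / (1 - k s * d z) ^ 2 - 2 * c z * d z * k1 s ^ 2 / (1 - k s * d z) ^ 3 with hhss
  set hm : ℝ → ℝ → ℝ := fun s z => g1 z - k s * c1 z / (1 - k s * d z) - k s ^ 2 * c z / (1 - k s * d z) ^ 2 with hhm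
  set hmm : ℝ → ℝ → ℝ := fun s z => g2 z - k s * c2 z / (1 - k s * d z) - 2 * k s ^ 2 * c1 z / (1 - k s * d z) ^ 2
    - 2 * k s ^ 3 * c z / (1 - k s * d z) ^ 3 with hhmm
  set hmmm : ℝ → ℝ → ℝ := fun s z => g3 z - k s * c3 z / (1 - k s * d z) - 3 * k s ^ 2 * c2 z / (1 - k s * d z) ^ 2
    - 6 * k s ^ 3 * c1 z / (1 - k s * d z) ^ 3 - 6 * k s ^ 4 * c z / (1 - k s * d z) ^ 4 with hhmmm
  set hsm : ℝ → ℝ → ℝ := fun s z => -(c1 z * k1 s / (1 - k s * d z) ^ 2) - 2 * c z * k s * k1 s / (1 - k s * d z) ^ 3 with hhsm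
  set hssm : ℝ → ℝ → ℝ := fun s z => -(c1 z * k2 s / (1 - k s * d z) ^ 2) - 2 * c z * k s * k2 s / (1 - k s * d z) ^ 3
    - 2 * (c1 z * d z + c z) * k1 s ^ 2 / (1 - k s * d z) ^ 3 - 6 * c z * d z * k s * k1 s ^ 2 / (1 - k s * d z) ^ 4 with hhssm
  /- derivative of `J` along each line -/
  have hJz : ∀ s, ∀ z ∈ I, HasDerivAt (fun z' : ℝ => 1 - k s * d z') (-(k s * d1 z)) z := fun s z hz => by
    simpa using ((hd z hz).const_mul (k s)).const_sub 1
  have hJs : ∀ s ∈ S, ∀ z, HasDerivAt (fun s' : ℝ => 1 - k s' * d z) (-(k1 s * d z)) s := fun s hsS' z => by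
    simpa using ((hk s hsS').mul_const (d z)).const_sub 1
  /- the jet links -/
  have L_ss : ∀ s ∈ S, ∀ z ∈ I, HasDerivAt (fun s' => hs s' z) (hss s z) s := by
    intro s hsS' z hzI'
    have hJ0 := hJ s hsS' z hzI'
    have h0 := hasDerivAt_div_pow 2 ((hk2 s hsS').const_mul (c z)) (hJs s hsS' z) rfl hJ0
    have key := (hα2 s hsS').sub h0
    have hfun : (fun s' => hs s' z) = fun s' => α1 s' - c z * k1 s' / (1 - k s' * d z) ^ 2 := by funext s'; simp only [hhs]
    rw [hfun]
    refine key.congr_deriv ?_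
    simp only [hhss]
    field_simp
    ring
  have L_m : ∀ s ∈ S, ∀ z ∈ I, HasDerivAt (fun z' => h s z') (d1 z * hm s z) z := by
    intro s hsS' z hzI'
    have hJ0 := hJ s hsS' z hzI'
    have h0 := hasDerivAt_div_pow 1 ((hc z hzI').mul_const (k s)) (hJz s z hzI') rfl hJ0
    have key := ((hg z hzI').const_add (α s)).sub h0
    have hfun : (fun z' => h s z') = fun z' => α s + g z' - c z' * k s / (1 - k s * d z') ^ 1 := by
      funext z'; simp only [hh, pow_one]
    rw [hfun]
    refine key.congr_deriv ?_
    simp only [hhm]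
    field_simp
    ring
  have L_mm : ∀ s ∈ S, ∀ z ∈ I, HasDerivAt (fun z' => hm s z') (d1 z * hmm s z) z := by
    intro s hsS' z hzI'
    have hJ0 := hJ s hsS' z hzI'
    have hA := hasDerivAt_div_pow 1 ((hc2 z hzI').const_mul (k s)) (hJz s z hzI') rfl hJ0
    have hB := hasDerivAt_div_pow 2 ((hc z hzI').const_mul (k s ^ 2)) (hJz s z hzI') rfl hJ0
    have key := ((hg2 z hzI').sub hA).sub hB
    have hfun : (fun z' => hm s z') = fun z' => g1 z' - k s * c1 z' / (1 - k s * d z') ^ 1 - k s ^ 2 * c z' / (1 - k s * d z') ^ 2 := by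
      funext z'; simp only [hhm, pow_one]
    rw [hfun]
    refine key.congr_deriv ?_
    simp only [hhmm]
    field_simp
    ring
  have L_mmm : ∀ s ∈ S, ∀ z ∈ I, HasDerivAt (fun z' => hmm s z') (d1 z * hmmm s z) z := by
    intro s hsS' z hzI'
    have hJ0 := hJ s hsS' z hzI'
    have hA := hasDerivAt_div_pow 1 ((hc3 z hzI').const_mul (k s)) (hJz s z hzI') rfl hJ0
    have hB := hasDerivAt_div_pow 2 ((hc2 z hzI').const_mul (2 * k s ^ 2)) (hJz s z hzI') rfl hJ0
    have hC := hasDerivAt_div_pow 3 ((hc z hzI').const_mul (2 * k s ^ 3)) (hJz s z hzI') rfl hJ0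
    have key := (((hg3 z hzI').sub hA).sub hB).sub hC
    have hfun : (fun z' => hmm s z') = fun z' => g2 z' - k s * c2 z' / (1 - k s * d z') ^ 1 - 2 * k s ^ 2 * c1 z' / (1 - k s * d z') ^ 2
        - 2 * k s ^ 3 * c z' / (1 - k s * d z') ^ 3 := by
      funext z'; simp only [hhmm, pow_one]
    rw [hfun]
    refine key.congr_deriv ?_
    simp only [hhmmm]
    field_simp
    ring
  have L_sm : ∀ s ∈ S, ∀ z ∈ I, HasDerivAt (fun z' => hs s z') (d1 z * hsm s z) z := by
    intro s hsS' z hzI'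
    have hJ0 := hJ s hsS' z hzI'
    have hA := hasDerivAt_div_pow 2 ((hc z hzI').mul_const (k1 s)) (hJz s z hzI') rfl hJ0
    have key := (hasDerivAt_const z (α1 s)).sub hA
    have hfun : (fun z' => hs s z') = fun z' => α1 s - c z' * k1 s / (1 - k s * d z') ^ 2 := by funext z'; simp only [hhs]
    rw [hfun]
    refine key.congr_deriv ?_
    simp only [hhsm]
    field_simp
    ring
  have L_ssm : ∀ s ∈ S, ∀ z ∈ I, HasDerivAt (fun z' => hss s z') (d1 z * hssm s z) z := by
    intro s hsS' z hzI'
    have hJ0 := hJ s hsS' z hzI'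
    have hA := hasDerivAt_div_pow 2 ((hc z hzI').mul_const (k2 s)) (hJz s z hzI') rfl hJ0
    have hB' : HasDerivAt (fun z' => 2 * c z' * d z' * k1 s ^ 2) ((2 * (d1 z * c1 z) * d z + 2 * c z * d1 z) * k1 s ^ 2) z :=
      (((hc z hzI').const_mul 2).mul (hd z hzI')).mul_const (k1 s ^ 2)
    have hB := hasDerivAt_div_pow 3 hB' (hJz s z hzI') rfl hJ0
    have key := ((hasDerivAt_const z (α2 s)).sub hA).sub hB
    have hfun : (fun z' => hss s z') = fun z' => α2 s - c z' * k2 s / (1 - k s * d z') ^ 2 - 2 * c z' * d z' * k1 s ^ 2 / (1 - k s * d z') ^ 3 := by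
      funext z'; simp only [hhss]
    rw [hfun]
    refine key.congr_deriv ?_
    simp only [hhssm]
    field_simp
    ring
  -- (1′), (2′) in the jet currency
  have h1' : ∀ s ∈ S, ∀ z ∈ I, hs s z = (1 - k s * d z) * Pm s z - k s * P s z := fun s hsS' z hzI' => by
    simp only [hhs]; exact h1 s hsS' z hzI'
  have h2' : ∀ s ∈ S, ∀ z ∈ I, Ps s z = -(1 - k s * d z) * hm s z + k s * h s z + (1 - k s * d z) * t z := fun s hsS' z hzI' => by
    simp only [hhm, hh]; exact h2 s hsS' z hzI'
  /- Part A, then the explicit substitution -/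
  have hE2 := tower_identity_abstract_height hS hI hk hd hd0 ht ht2 L_ss L_m L_mm L_mmm L_sm L_ssm P_s P_m P_sm P_ms h1' h2' hsS hzI
  simp only [hh, hhs, hhss, hhm, hhmm, hhmmm, hhsm, hhssm] at hE2
  have hJne := hJ s hsS z hzI
  field_simp at hE2
  linear_combination -hE2

end explicitElim

end Summit.NavierStokesRegularity.NavierStokesRegularity.Theorems.PoloidalWindowDoorLrcModEntireCurvedTowerElimHeight

end
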